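import Literature.RingTheory.FormalGroups.NilpotentEvaluationPair     -- ★ p844734 (β) part 1: `evalNilp₂`, `evalNilp₂_eq_sum_Iic`, `exists_box`
import Mathlib.RingTheory.MvPowerSeries.Substitution
import HarnessLib

/-!
# Bridge: Mathlib's topological evaluation `MvPowerSeries.aeval` at a NILPOTENT tuple (discrete uniformities) is a finite box
# sum, and in two variables it is ★ `evalNilp₂` ([Bourbaki, Algebra II] Ch. IV §4 no. 3)

Topic `Literature/RingTheory/FormalGroups`; namespace `Literature.RingTheory.FormalGroups`.  THEOREMS ONLY (no definition, no named
fact, no instance, no notation, no `sorry`).  Cell `hodgecm-mathlib`, P6 «MOD programme», sub-desk F0P6d, letter (HL-D), LEAD HAND σ1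
step (P3) (associativity below the box): the ★ (β) engine (`evalNilp`, `evalNilp₂`: topology-free evaluation at nilpotents in ONE and
TWO variables) does not reach the THREE-variable associativity identity; Mathlib's `MvPowerSeries.aeval` (any number of variables,
with `MvPowerSeries.comp_subst_apply` «evaluation commutes with substitution») does, once the target algebra carries the DISCRETE
uniformity (`letI : UniformSpace T := ⊥`).  This file is the bridge: under `[DiscreteUniformity k] [DiscreteUniformity T]`,
`aeval` at a nilpotent tuple is the finite box sum `Σ_{d ≤ n} F_d ∏ aₛ^{dₛ}` (`aeval_eq_sum_Iic`), hence equals ★ `evalNilp₂` in two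
variables (`aeval_eq_evalNilp₂`); `hasEval_of_isNilpotent` supplies the `HasEval` witness.  USAGE (for the (P3) hand): with
`letI : UniformSpace k := ⊥`, `haveI : DiscreteUniformity k := ⟨rfl⟩`, the same on the test algebra `T`, and
`haveI : ContinuousSMul k T := ⟨continuous_of_discreteTopology⟩` (under `open scoped MvPowerSeries.WithPiTopology`), one gets
`ε := MvPowerSeries.aeval (hasEval_of_isNilpotent hx) : k⟦X₀,X₁,X₂⟧ →ₐ[k] T` and
`ε (P.subst ![u, v]) = evalNilp₂ P (ε u) (ε v)` from `MvPowerSeries.comp_subst_apply` + `aeval_eq_evalNilp₂`.  CAVEAT recorded for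
that hand: a test algebra that is syntactically a QUOTIENT `R ⧸ I` of a topological ring inherits Mathlib's
`topologicalRingQuotientTopology` instance, which competes with `⊥` — pick a test algebra without an inherited topology, or work
with the inherited one.  HC_CM is proved only modulo the printed citations until rung 0 closes; nothing here is about HC.

MAIN STATEMENTS.  `prod_pow_eq_zero_of_not_le`, `hasEval_of_isNilpotent`, **`aeval_eq_sum_Iic`**, **`aeval_eq_evalNilp₂`**.

## References
* [BourbakiAlgebraII2003] N. Bourbaki, *Algebra II*, Ch. IV §4 no. 3 (substitution ∕ evaluation of formal power series).
-/

noncomputable section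

universe u

open Filter
open scoped MvPowerSeries.WithPiTopology

namespace Literature.RingTheory.FormalGroups

variable {k : Type u} [CommRing k]

/-! ## Mathlib's evaluation at a nilpotent tuple (discrete uniformities) as a box sum; the `Fin 2` case is ★ `evalNilp₂` -/

section Eval

variable {σ : Type*} [Fintype σ] {T : Type u} [CommRing T] [Algebra k T]

/-- The monomial value `∏ aₛ^{dₛ}` vanishes outside the box `d ≤ n` when `aₛ^{nₛ+1} = 0`. [cite: BourbakiAlgebraII2003, Ch. IV §4 no. 3] -/
theorem prod_pow_eq_zero_of_not_le {a : σ → T} {n d : σ →₀ ℕ} (ha : ∀ s, a s ^ (n s + 1) = 0) (hd : ¬ d ≤ n) :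
    (d.prod fun s e => a s ^ e) = 0 := by
  rw [Finsupp.le_def] at hd
  push Not at hd
  obtain ⟨s, hs⟩ := hd
  rw [Finsupp.prod_fintype _ _ (fun i => pow_zero _)]
  refine Finset.prod_eq_zero (Finset.mem_univ s) ?_
  rw [show d s = (n s + 1) + (d s - (n s + 1)) by omega, pow_add, ha s, zero_mul]

variable [UniformSpace k] [DiscreteUniformity k] [UniformSpace T] [DiscreteUniformity T] [ContinuousSMul k T]

/-- A nilpotent tuple can be evaluated at (discrete topologies). [cite: BourbakiAlgebraII2003, Ch. IV §4 no. 3] -/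
theorem hasEval_of_isNilpotent {a : σ → T} (ha : ∀ s, IsNilpotent (a s)) : MvPowerSeries.HasEval a :=
  ⟨fun s => (ha s).isTopologicallyNilpotent, by simp⟩

/-- **Mathlib's `MvPowerSeries.aeval` at a nilpotent tuple, in DISCRETE uniformities, is the finite box sum
`Σ_{d ≤ n} F_d · ∏ aₛ^{dₛ}`.** [cite: BourbakiAlgebraII2003, Ch. IV §4 no. 3] -/
theorem aeval_eq_sum_Iic [DecidableEq σ] {a : σ → T} (ha : MvPowerSeries.HasEval a) {n : σ →₀ ℕ} (han : ∀ s, a s ^ (n s + 1) = 0)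
    (F : MvPowerSeries σ k) :
    MvPowerSeries.aeval ha F = ∑ d ∈ Finset.Iic n, MvPowerSeries.coeff d F • d.prod fun s e => a s ^ e := by
  rw [MvPowerSeries.aeval_eq_sum ha F, tsum_eq_sum]
  intro d hd
  rw [Finset.mem_Iic] at hd
  rw [prod_pow_eq_zero_of_not_le han hd, smul_zero]

end Eval

/-- In two variables this is ★ `evalNilp₂`. [cite: BourbakiAlgebraII2003, Ch. IV §4 no. 3] -/
theorem aeval_eq_evalNilp₂ {T : Type u} [CommRing T] [Algebra k T] [UniformSpace k] [DiscreteUniformity k] [UniformSpace T]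
    [DiscreteUniformity T] [ContinuousSMul k T] {a : Fin 2 → T} (ha : MvPowerSeries.HasEval a)
    (h0 : IsNilpotent (a 0)) (h1 : IsNilpotent (a 1)) (F : MvPowerSeries (Fin 2) k) :
    MvPowerSeries.aeval ha F = evalNilp₂ F (a 0) (a 1) := by
  obtain ⟨n, hn0, hn1⟩ := exists_box h0 h1
  have han : ∀ s : Fin 2, a s ^ (n s + 1) = 0 := fun s => by fin_cases s <;> assumption
  rw [aeval_eq_sum_Iic ha han, evalNilp₂_eq_sum_Iic F hn0 hn1]
  refine Finset.sum_congr rfl fun d _ => ?_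
  rw [Algebra.smul_def, Finsupp.prod_fintype _ _ (fun i => pow_zero _), Fin.prod_univ_two]

end Literature.RingTheory.FormalGroups
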